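import Summits.Ventures.HSemireg.WedgeHankelTuples

/-!
# Venture HSemireg — THEOREM H (2/4): the inductive step (one fresh pair; Pascal on ranks)

HONEST FRAMING. Part of the Lean index of the computation cell `pub-hsemireg` (seat p3; Sunday enclosure of the
FORMULA-N kernel assets of seats th-7 / th-6, ENCLOSURE-PLAN-p3.md).  Finite-dimensional exterior algebra over a field ONLY:
no variety, no cohomology theory, no semiregularity map is constructed here; nothing here says that HC / HC_CM / HC_AV holds;
no Literature fact is declared or used.  The geometric DICTIONARY (why these ranks are the `HT`-side box ranks of the cell's
STRUCTURE.md §1 / theory/FORMULA-N.md) lives in theory/FORMULA-N-th7.md PART B §A.3 / §N and is NOT asserted in Lean.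

THEOREM H, file 2 of 4 (th-7 HankelRank.lean l.441–777): THE INDUCTIVE STEP for one fresh pair of generators `x = e_i`, `y = e_j`
(`i, j ∉ D`, `i ≠ j`) and ARRAYS `F₁ F₂ : α → β → HT` of `D`-homogeneous classes of degree `d₀`: with `F⁺ a := F₁ a · x + F₂ a · y`,
column doubling `colDbl` and row doubling `rowDbl`, the splitting `Hom_{k+1}(D ⊔ {x,y}) = Hom_{k+1}(D) ⊕ Hom_k(D)x ⊕ Hom_k(D)y ⊕
Hom_{k−1}(D)xy` and the sign-free independence `triple_eq_zero` give `finrank_JRsum_succ : dim JRsum_{k+1}(D ⊔ {x,y}; F⁺) =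
dim JRsum_{k+1}(D; colDbl) + dim JRsum_k(D; rowDbl)` and `finrank_JRsum_zero` — PASCAL's rule on the rank side.  One `section`
with `include`d hypotheses (th-7's text verbatim; namespace `HSemiregHankel` ↦ `Summit.Ventures.HSemireg.Wedge.Hankel`).
-/

open Module Set Set.powersetCard

namespace Summit.Ventures.HSemireg.Wedge.Hankel

variable (K : Type*) [Field K] {I : Type*} [LinearOrder I] [Fintype I]

section Step

variable {α β : Type*} {D : Finset I} {i j : I} {d₀ : ℕ}
variable (hi : i ∉ D) (hj : j ∉ D) (hij : i ≠ j)
variable {F₁ F₂ : α → β → HT K I} (hF₁ : ∀ a c, F₁ a c ∈ Hom K I D d₀) (hF₂ : ∀ a c, F₂ a c ∈ Hom K I D d₀)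

/-- the new classes `F⁺ a c = F₁ a c · x + F₂ a c · y`. -/
noncomputable def Fplus (F₁ F₂ : α → β → HT K I) (i j : I) : α → β → HT K I :=
  fun a c => F₁ a c * gx K i + F₂ a c * gx K j

/-- columns doubled: `a ↦ (F₁ a | F₂ a)` on `β ⊕ β`. -/
def colDbl (F₁ F₂ : α → β → HT K I) : α → (β ⊕ β) → HT K I := fun a => Sum.elim (F₁ a) (F₂ a)

/-- rows doubled: `(F₂ ; F₁)` on `α ⊕ α`. -/
def rowDbl (F₁ F₂ : α → β → HT K I) : (α ⊕ α) → β → HT K I := Sum.elim F₂ F₁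

/-- a generator commutes past a degree-`d₀` element up to `(-1)^{d₀}`. -/
lemma x_mul_of_mem_Hom {f : HT K I} (hf : f ∈ Hom K I D d₀) (i : I) :
    gx K i * f = ((-1 : K) ^ d₀) • (f * gx K i) := by
  rw [gx, B_mul_comm_of_mem_Hom K hf, Finset.card_singleton, one_mul]

/-! atomic products `x f x = 0`, `x f y = ε f x y`, `y f x = −ε f x y`, `y f y = 0`, `(x y) f x = (x y) f y = 0` -/

/-- `x (f x) = 0` for homogeneous `f`. -/
lemma xfx {f : HT K I} (hf : f ∈ Hom K I D d₀) (i : I) : gx K i * (f * gx K i) = 0 := by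
  rw [← mul_assoc, x_mul_of_mem_Hom K hf, smul_mul_assoc, mul_assoc, gx_mul_self, mul_zero, smul_zero]

/-- `x (f y) = (-1)^{d₀} f (x y)` for homogeneous `f` of degree `d₀`. -/
lemma xfy {f : HT K I} (hf : f ∈ Hom K I D d₀) (i j : I) :
    gx K i * (f * gx K j) = ((-1 : K) ^ d₀) • (f * (gx K i * gx K j)) := by
  rw [← mul_assoc, x_mul_of_mem_Hom K hf, smul_mul_assoc, mul_assoc]

/-- `y (f x) = -(-1)^{d₀} f (x y)` for homogeneous `f` of degree `d₀`. -/
lemma yfx {f : HT K I} (hf : f ∈ Hom K I D d₀) (i j : I) :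
    gx K j * (f * gx K i) = -(((-1 : K) ^ d₀) • (f * (gx K i * gx K j))) := by
  rw [← mul_assoc, x_mul_of_mem_Hom K hf, smul_mul_assoc, mul_assoc, gy_mul_gx K, mul_neg, smul_neg]

/-- `(x y)(f x) = 0` for homogeneous `f`. -/
lemma xyfx {f : HT K I} (hf : f ∈ Hom K I D d₀) (i j : I) : gx K i * gx K j * (f * gx K i) = 0 := by
  rw [mul_assoc, yfx K hf, mul_neg, mul_smul_comm, ← mul_assoc (gx K i) f, x_mul_of_mem_Hom K hf,
    smul_mul_assoc, mul_assoc f, ← mul_assoc (gx K i) (gx K i), gx_mul_self, zero_mul, mul_zero,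
    smul_zero, smul_zero, neg_zero]

/-- `(x y)(f y) = 0` for homogeneous `f`. -/
lemma xyfy {f : HT K I} (hf : f ∈ Hom K I D d₀) (i j : I) : gx K i * gx K j * (f * gx K j) = 0 := by
  rw [mul_assoc, ← mul_assoc (gx K j), x_mul_of_mem_Hom K hf, smul_mul_assoc, mul_assoc, gx_mul_self,
    mul_zero, smul_zero, mul_zero]

/-- (b0) `θ₀ · F⁺ = Λ₂₃ (θ₀ F₁, θ₀ F₂)`. -/
lemma L_Fplus_base (a : α) (θ : HT K I) :
    L K (Fplus K F₁ F₂ i j a) θ = Lam23 K i j (L2 K (F₁ a) (F₂ a) θ) := by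
  funext c
  simp [Fplus, mul_add, mul_assoc]

include hF₁ hF₂ in
/-- (b1) `(θ x) · F⁺ = Λ₄ (ε • θ F₂)`. -/
lemma L_Fplus_x (a : α) (θ : HT K I) :
    L K (Fplus K F₁ F₂ i j a) (θ * gx K i) = Lam4 K i j (((-1 : K) ^ d₀) • L K (F₂ a) θ) := by
  funext c
  simp only [L_apply, Fplus, Lam4_apply, Pi.smul_apply, mul_add, mul_assoc, xfx K (hF₁ a c),
    xfy K (hF₂ a c), mul_zero, zero_add, mul_smul_comm, smul_mul_assoc]

include hF₁ hF₂ in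
/-- (b2) `(θ y) · F⁺ = Λ₄ (−ε • θ F₁)`. -/
lemma L_Fplus_y (a : α) (θ : HT K I) :
    L K (Fplus K F₁ F₂ i j a) (θ * gx K j) = Lam4 K i j (-(((-1 : K) ^ d₀) • L K (F₁ a) θ)) := by
  funext c
  simp only [L_apply, Fplus, Lam4_apply, Pi.smul_apply, Pi.neg_apply, mul_add, mul_assoc,
    yfx K (hF₁ a c), xfx K (hF₂ a c), mul_zero, add_zero, mul_neg, mul_smul_comm, smul_mul_assoc,
    neg_mul]

include hF₁ hF₂ in
/-- (b3) `(θ x y) · F⁺ = 0`. -/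
lemma L_Fplus_xy (a : α) (θ : HT K I) :
    L K (Fplus K F₁ F₂ i j a) (θ * (gx K i * gx K j)) = 0 := by
  funext c
  simp only [L_apply, Fplus, Pi.zero_apply, mul_add]
  rw [mul_assoc θ, mul_assoc θ, xyfx K (hF₁ a c), xyfy K (hF₂ a c), mul_zero, add_zero]

/-! #### (a) decomposition of the degree-(k+1) monomials on `D ∪ {i,j}` -/

include hi hj hij in
/-- SPLITTING: `Hom_{k+1}(D ⊔ {x,y}) ≤ Hom_{k+1}(D) ⊔ Hom_k(D)·x ⊔ Hom_k(D)·y ⊔ Alg(D)·(xy)`. -/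
lemma Hom_insert2_le (k : ℕ) :
    Hom K I (insert i (insert j D)) (k + 1) ≤
      Hom K I D (k + 1) ⊔ (Hom K I D k).map (LinearMap.mulRight K (gx K i))
        ⊔ (Hom K I D k).map (LinearMap.mulRight K (gx K j))
        ⊔ (Alg K I D).map (LinearMap.mulRight K (gx K i * gx K j)) := by
  classical
  rw [Hom, Submodule.span_le]
  rintro _ ⟨s, ⟨hs, hcard⟩, rfl⟩
  rw [SetLike.mem_coe]
  change B K I s ∈ _
  have hsub : ∀ x ∈ s, x ≠ i → x ≠ j → x ∈ D := by
    intro x hx hxi hxj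
    have := hs hx
    rw [Finset.mem_insert, Finset.mem_insert] at this
    rcases this with h | h | h
    · exact (hxi h).elim
    · exact (hxj h).elim
    · exact h
  by_cases hi' : i ∈ s <;> by_cases hj' : j ∈ s
  · -- both: B s = c • (B s₀ * (x y)), s₀ = (s.erase i).erase j
    set s₀ := (s.erase i).erase j with hs₀
    have hs₀D : s₀ ⊆ D := by
      intro x hx
      rw [hs₀, Finset.mem_erase, Finset.mem_erase] at hx
      exact hsub x hx.2.2 hx.2.1 hx.1
    have hdisj : Disjoint s₀ {i, j} := by
      rw [Finset.disjoint_insert_right, Finset.disjoint_singleton_right, hs₀]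
      exact ⟨fun h => (Finset.mem_erase.mp (Finset.mem_erase.mp h).2).1 rfl,
        fun h => (Finset.mem_erase.mp h).1 rfl⟩
    have hunion : s₀ ∪ {i, j} = s := by
      rw [hs₀]
      ext x
      simp only [Finset.mem_union, Finset.mem_erase, Finset.mem_insert, Finset.mem_singleton]
      constructor
      · rintro (⟨-, -, hx⟩ | rfl | rfl) <;> assumption
      · intro hx
        by_cases hxi : x = i
        · exact Or.inr (Or.inl hxi)
        by_cases hxj : x = j
        · exact Or.inr (Or.inr hxj)
        · exact Or.inl ⟨hxj, hxi, hx⟩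
    have hprod : B K I s₀ * (gx K i * gx K j) = (u K {i} {j} * u K s₀ {i, j}) • B K I s := by
      rw [gx_mul_gy, mul_smul_comm, B_mul_B, smul_smul, hunion]
    have hc : u K {i} {j} * u K s₀ {i, j} ≠ 0 :=
      mul_ne_zero (u_pair_ne_zero K hij) ((u_ne_zero_iff K).mpr hdisj)
    have hBs : B K I s = (u K {i} {j} * u K s₀ {i, j})⁻¹ • (B K I s₀ * (gx K i * gx K j)) := by
      rw [hprod, smul_smul, inv_mul_cancel₀ hc, one_smul]
    rw [hBs]
    apply Submodule.mem_sup_right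
    exact Submodule.smul_mem _ _ ⟨B K I s₀, B_mem_Alg K hs₀D, rfl⟩
  · -- i ∈ s, j ∉ s
    set s₀ := s.erase i with hs₀
    have hs₀D : s₀ ⊆ D := by
      intro x hx
      rw [hs₀, Finset.mem_erase] at hx
      exact hsub x hx.2 hx.1 (fun h => hj' (h ▸ hx.2))
    have hdisj : Disjoint s₀ {i} := by
      rw [Finset.disjoint_singleton_right, hs₀]; exact Finset.notMem_erase i s
    have hunion : s₀ ∪ {i} = s := by
      rw [hs₀, Finset.union_comm, ← Finset.insert_eq, Finset.insert_erase hi']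
    have hcard₀ : s₀.card = k := by
      rw [hs₀, Finset.card_erase_of_mem hi', hcard]; rfl
    have hprod : B K I s₀ * gx K i = u K s₀ {i} • B K I s := by
      rw [gx, B_mul_B, hunion]
    have hc : u K s₀ {i} ≠ 0 := (u_ne_zero_iff K).mpr hdisj
    have hBs : B K I s = (u K s₀ {i})⁻¹ • (B K I s₀ * gx K i) := by
      rw [hprod, smul_smul, inv_mul_cancel₀ hc, one_smul]
    rw [hBs]
    apply Submodule.mem_sup_left; apply Submodule.mem_sup_left; apply Submodule.mem_sup_right
    exact Submodule.smul_mem _ _ ⟨B K I s₀, B_mem_Hom K hs₀D hcard₀, rfl⟩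
  · -- j ∈ s, i ∉ s
    set s₀ := s.erase j with hs₀
    have hs₀D : s₀ ⊆ D := by
      intro x hx
      rw [hs₀, Finset.mem_erase] at hx
      exact hsub x hx.2 (fun h => hi' (h ▸ hx.2)) hx.1
    have hdisj : Disjoint s₀ {j} := by
      rw [Finset.disjoint_singleton_right, hs₀]; exact Finset.notMem_erase j s
    have hunion : s₀ ∪ {j} = s := by
      rw [hs₀, Finset.union_comm, ← Finset.insert_eq, Finset.insert_erase hj']
    have hcard₀ : s₀.card = k := by
      rw [hs₀, Finset.card_erase_of_mem hj', hcard]; rfl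
    have hprod : B K I s₀ * gx K j = u K s₀ {j} • B K I s := by
      rw [gx, B_mul_B, hunion]
    have hc : u K s₀ {j} ≠ 0 := (u_ne_zero_iff K).mpr hdisj
    have hBs : B K I s = (u K s₀ {j})⁻¹ • (B K I s₀ * gx K j) := by
      rw [hprod, smul_smul, inv_mul_cancel₀ hc, one_smul]
    rw [hBs]
    apply Submodule.mem_sup_left; apply Submodule.mem_sup_right
    exact Submodule.smul_mem _ _ ⟨B K I s₀, B_mem_Hom K hs₀D hcard₀, rfl⟩
  · -- neither
    have hsD : s ⊆ D := fun x hx => hsub x hx (fun h => hi' (h ▸ hx)) (fun h => hj' (h ▸ hx))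
    apply Submodule.mem_sup_left; apply Submodule.mem_sup_left; apply Submodule.mem_sup_left
    exact B_mem_Hom K hsD hcard

/-- degree 0: `Hom D' 0 ≤ Hom D 0` for any `D, D'` (only the empty monomial). -/
lemma Hom_zero_le (D D' : Finset I) : Hom K I D' 0 ≤ Hom K I D 0 := by
  rw [Hom, Submodule.span_le]
  rintro _ ⟨s, ⟨-, hcard⟩, rfl⟩
  rw [Finset.card_eq_zero] at hcard
  subst hcard
  exact B_mem_Hom K (Finset.empty_subset D) rfl

/-! #### (c) the range identity -/

include hi hj hij hF₁ hF₂ in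
/-- image of `Hom_{k+1}(D ⊔ {x,y})` under the tuple map of `F⁺ = F₁ x + F₂ y`: the `Lam23`-part plus the `Lam4`-part. -/
lemma map_L_Fplus_succ (a : α) (k : ℕ) :
    (Hom K I (insert i (insert j D)) (k + 1)).map (L K (Fplus K F₁ F₂ i j a)) =
      ((Hom K I D (k + 1)).map (L2 K (F₁ a) (F₂ a))).map (Lam23 K i j) ⊔
      (JR K I D k (F₂ a) ⊔ JR K I D k (F₁ a)).map (Lam4 K i j) := by
  have hDD' : D ⊆ insert i (insert j D) := fun x hx =>
    Finset.mem_insert_of_mem (Finset.mem_insert_of_mem hx)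
  have hε : ((-1 : K) ^ d₀) * ((-1 : K) ^ d₀) = 1 := by
    rw [← pow_add, ← two_mul, pow_mul, neg_one_sq, one_pow]
  apply le_antisymm
  · rw [Submodule.map_le_iff_le_comap]
    refine (Hom_insert2_le K hi hj hij k).trans ?_
    refine sup_le (sup_le (sup_le ?_ ?_) ?_) ?_
    · intro θ hθ
      rw [Submodule.mem_comap, L_Fplus_base]
      exact Submodule.mem_sup_left ⟨_, ⟨θ, hθ, rfl⟩, rfl⟩
    · rintro _ ⟨θ, hθ, rfl⟩
      rw [Submodule.mem_comap, LinearMap.mulRight_apply, L_Fplus_x K hF₁ hF₂]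
      refine Submodule.mem_sup_right ⟨_, Submodule.mem_sup_left (Submodule.smul_mem _ _ ⟨θ, hθ, rfl⟩), rfl⟩
    · rintro _ ⟨θ, hθ, rfl⟩
      rw [Submodule.mem_comap, LinearMap.mulRight_apply, L_Fplus_y K hF₁ hF₂]
      refine Submodule.mem_sup_right ⟨_, Submodule.mem_sup_right
        (Submodule.neg_mem _ (Submodule.smul_mem _ _ ⟨θ, hθ, rfl⟩)), rfl⟩
    · rintro _ ⟨θ, -, rfl⟩
      rw [Submodule.mem_comap, LinearMap.mulRight_apply, L_Fplus_xy K hF₁ hF₂]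
      exact Submodule.zero_mem _
  · refine sup_le ?_ ?_
    · rintro _ ⟨_, ⟨θ, hθ, rfl⟩, rfl⟩
      rw [← L_Fplus_base]
      exact ⟨θ, Hom_mono K hDD' _ hθ, rfl⟩
    · rw [Submodule.map_sup]
      refine sup_le ?_ ?_
      · rintro _ ⟨_, ⟨θ, hθ, rfl⟩, rfl⟩
        -- Λ₄ (θ F₂) = ε • L F⁺ (θ x)
        refine ⟨((-1 : K) ^ d₀) • (θ * gx K i), Submodule.smul_mem _ _ ?_, ?_⟩
        · have := mul_B_mem_Hom K hDD' (s := {i}) (by simp) hθ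
          rwa [Finset.card_singleton] at this
        · rw [map_smul, L_Fplus_x K hF₁ hF₂, map_smul, smul_smul, hε, one_smul]
      · rintro _ ⟨_, ⟨θ, hθ, rfl⟩, rfl⟩
        refine ⟨(-((-1 : K) ^ d₀)) • (θ * gx K j), Submodule.smul_mem _ _ ?_, ?_⟩
        · have := mul_B_mem_Hom K hDD' (s := {j}) (by simp) hθ
          rwa [Finset.card_singleton] at this
        · rw [map_smul, L_Fplus_y K hF₁ hF₂, map_neg, map_smul, smul_neg, neg_smul, neg_neg, smul_smul,
            hε, one_smul]

/-- degree-zero case of `map_L_Fplus_succ`: only the `Lam23`-part survives. -/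
lemma map_L_Fplus_zero (D' : Finset I) (a : α) :
    (Hom K I D' 0).map (L K (Fplus K F₁ F₂ i j a)) =
      ((Hom K I D 0).map (L2 K (F₁ a) (F₂ a))).map (Lam23 K i j) := by
  apply le_antisymm
  · rintro _ ⟨θ, hθ, rfl⟩
    rw [L_Fplus_base]
    exact ⟨_, ⟨θ, Hom_zero_le K D D' hθ, rfl⟩, rfl⟩
  · rintro _ ⟨_, ⟨θ, hθ, rfl⟩, rfl⟩
    rw [← L_Fplus_base]
    exact ⟨θ, Hom_zero_le K D' D hθ, rfl⟩

/-! #### (e) the finrank bookkeeping -/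

include hi hj hij in
/-- `Λ₂₃ g + Λ₄ h = 0` with `Alg D`-valued `g, h` forces `g = 0, h = 0`. -/
lemma Lam_indep {g : (β → HT K I) × (β → HT K I)} {h : β → HT K I}
    (hg : g ∈ (piAlg K D).prod (piAlg K (β := β) D)) (hh : h ∈ piAlg K (β := β) D)
    (h0 : Lam23 K i j g + Lam4 K i j h = 0) : g = 0 ∧ h = 0 := by
  rw [Submodule.mem_prod, mem_piAlg, mem_piAlg] at hg
  rw [mem_piAlg] at hh
  have hc : ∀ c, g.1 c = 0 ∧ g.2 c = 0 ∧ h c = 0 := by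
    intro c
    have := congr_fun h0 c
    simp only [Pi.add_apply, Lam23_apply, Lam4_apply, Pi.zero_apply] at this
    exact triple_eq_zero K hi hj hij (hg.1 c) (hg.2 c) (hh c) this
  refine ⟨Prod.ext (funext fun c => (hc c).1) (funext fun c => (hc c).2.1), funext fun c => (hc c).2.2⟩

include hi hj hij in
/-- the `Lam23`-image and the `Lam4`-image are independent and `Lam23`, `Lam4` are injective on `piAlg D`-data: dimensions add. -/
lemma finrank_sup_Lam [Fintype β] {P : Submodule K ((β → HT K I) × (β → HT K I))} {Q : Submodule K (β → HT K I)}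
    (hP : P ≤ (piAlg K D).prod (piAlg K (β := β) D)) (hQ : Q ≤ piAlg K (β := β) D) :
    Module.finrank K ↥(P.map (Lam23 K i j) ⊔ Q.map (Lam4 K i j)) =
      Module.finrank K P + Module.finrank K Q := by
  have hinf : P.map (Lam23 K i j) ⊓ Q.map (Lam4 K i j) = ⊥ := by
    rw [eq_bot_iff]
    rintro z ⟨⟨g, hg, rfl⟩, ⟨h, hh, hz⟩⟩
    have h0 : Lam23 K i j g + Lam4 K i j (-h) = 0 := by rw [map_neg, hz, add_neg_cancel]
    have := (Lam_indep K hi hj hij (hP hg) (hQ (Q.neg_mem hh)) h0).1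
    rw [Submodule.mem_bot, this, map_zero]
  have h1 := Submodule.finrank_sup_add_finrank_inf_eq (P.map (Lam23 K i j)) (Q.map (Lam4 K i j))
  rw [hinf, finrank_bot, add_zero] at h1
  rw [h1, finrank_map_of_injOn K _ _ (fun g hg hg0 => (Lam_indep K hi hj hij (hP hg)
      (Submodule.zero_mem _) (by rw [hg0, map_zero, add_zero])).1),
    finrank_map_of_injOn K _ _ (fun h hh hh0 => (Lam_indep K hi hj hij (g := 0)
      (Submodule.zero_mem _) (hQ hh) (by rw [hh0, map_zero, add_zero])).2)]

/-- the product side `⨆_a (Hom D k).map (L2 (F₁ a) (F₂ a))` is the joint-range sum of the column-doubled array. -/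
lemma finrank_iSup_L2 [Fintype β] (k : ℕ) :
    Module.finrank K ↥(⨆ a, (Hom K I D k).map (L2 K (F₁ a) (F₂ a))) =
      Module.finrank K ↥(JRsum K I D k (colDbl K F₁ F₂)) := by
  let e : ((β → HT K I) × (β → HT K I)) ≃ₗ[K] (β ⊕ β → HT K I) :=
    (LinearEquiv.sumArrowLequivProdArrow β β K (HT K I)).symm
  have he : ∀ a, ((Hom K I D k).map (L2 K (F₁ a) (F₂ a))).map (e : _ →ₗ[K] _) =
      JR K I D k (colDbl K F₁ F₂ a) := by
    intro a
    rw [JR, ← Submodule.map_comp]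
    congr 1
    apply LinearMap.ext
    intro θ
    funext c
    rcases c with c | c
    · rfl
    · rfl
  rw [← LinearEquiv.finrank_map_eq e,
    show (⨆ a, (Hom K I D k).map (L2 K (F₁ a) (F₂ a))).map (e : _ →ₗ[K] _) =
      JRsum K I D k (colDbl K F₁ F₂) from by rw [Submodule.map_iSup]; exact iSup_congr he]

/-- the supremum over `a` of `JR(F₂ a) ⊔ JR(F₁ a)` is the `JRsum` of the row-doubled family. -/
lemma iSup_S2_eq (k : ℕ) :
    (⨆ a, (JR K I D k (F₂ a) ⊔ JR K I D k (F₁ a))) = JRsum K I D k (rowDbl K F₁ F₂) := by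
  rw [iSup_sup_eq, JRsum, iSup_sum]
  rfl

include hi hj hij hF₁ hF₂ in
/-- **THE INDUCTIVE STEP, degree k+1.** -/
theorem finrank_JRsum_succ [Fintype β] (k : ℕ) :
    Module.finrank K ↥(JRsum K I (insert i (insert j D)) (k + 1) (Fplus K F₁ F₂ i j)) =
      Module.finrank K ↥(JRsum K I D (k + 1) (colDbl K F₁ F₂)) +
      Module.finrank K ↥(JRsum K I D k (rowDbl K F₁ F₂)) := by
  have hJ : JRsum K I (insert i (insert j D)) (k + 1) (Fplus K F₁ F₂ i j) =
      (⨆ a, (Hom K I D (k + 1)).map (L2 K (F₁ a) (F₂ a))).map (Lam23 K i j) ⊔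
      (⨆ a, (JR K I D k (F₂ a) ⊔ JR K I D k (F₁ a))).map (Lam4 K i j) := by
    rw [JRsum, Submodule.map_iSup, Submodule.map_iSup, ← iSup_sup_eq]
    refine iSup_congr fun a => ?_
    rw [JR, map_L_Fplus_succ K hi hj hij hF₁ hF₂]
  rw [hJ, finrank_sup_Lam K hi hj hij, finrank_iSup_L2, iSup_S2_eq]
  · refine iSup_le fun a => ?_
    rintro _ ⟨θ, hθ, rfl⟩
    rw [Submodule.mem_prod, L2_apply, mem_piAlg, mem_piAlg]
    exact ⟨fun c => mul_mem_Alg K (Hom_le_Alg K D _ hθ) (Hom_le_Alg K D _ (hF₁ a c)),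
      fun c => mul_mem_Alg K (Hom_le_Alg K D _ hθ) (Hom_le_Alg K D _ (hF₂ a c))⟩
  · exact iSup_le fun a => sup_le (JR_le_piAlg K (hF₂ a)) (JR_le_piAlg K (hF₁ a))

include hi hj hij hF₁ hF₂ in
/-- **THE INDUCTIVE STEP, degree 0.** -/
theorem finrank_JRsum_zero [Fintype β] :
    Module.finrank K ↥(JRsum K I (insert i (insert j D)) 0 (Fplus K F₁ F₂ i j)) =
      Module.finrank K ↥(JRsum K I D 0 (colDbl K F₁ F₂)) := by
  have hJ : JRsum K I (insert i (insert j D)) 0 (Fplus K F₁ F₂ i j) =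
      (⨆ a, (Hom K I D 0).map (L2 K (F₁ a) (F₂ a))).map (Lam23 K i j) ⊔
      (⊥ : Submodule K (β → HT K I)).map (Lam4 K i j) := by
    rw [Submodule.map_bot, sup_bot_eq, JRsum, Submodule.map_iSup]
    refine iSup_congr fun a => ?_
    rw [JR, map_L_Fplus_zero K (D := D)]
  rw [hJ, finrank_sup_Lam K hi hj hij, finrank_iSup_L2, finrank_bot, add_zero]
  · refine iSup_le fun a => ?_
    rintro _ ⟨θ, hθ, rfl⟩
    rw [Submodule.mem_prod, L2_apply, mem_piAlg, mem_piAlg]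
    exact ⟨fun c => mul_mem_Alg K (Hom_le_Alg K D _ hθ) (Hom_le_Alg K D _ (hF₁ a c)),
      fun c => mul_mem_Alg K (Hom_le_Alg K D _ hθ) (Hom_le_Alg K D _ (hF₂ a c))⟩
  · exact bot_le

end Step

end Summit.Ventures.HSemireg.Wedge.Hankel
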